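import Mathlib.Analysis.Calculus.LocalExtr.Basic
import Literature.Topology.FourManifolds.GradientLike
import HarnessLib

/-!
# The differential of a function at a local minimum on a manifold with boundary

Topic `Literature/Topology/FourManifolds` (fact seat
`provefact-Literature.Topology.FourManifolds.exists-68ee520c9a`, Wall 1964, Lemma 2, the
splicing step of the Morse-theoretic route: two Morse functions of a triad which both vanish
exactly on the incoming boundary increase along a common vector field near it).  Everything here
is **proved**; no named facts.

Fermat's theorem on the model half-space `{y | 0 ≤ y 0}` of `𝓡∂ (n + 1)`: if `u : K → ℝ` on a
manifold with boundary `K` is differentiable at `p` and has a local minimum at `p`, then its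
differential `duₚ` (read in the extended chart at `p`, as Mathlib's `mfderiv`) kills every
vector tangent to the boundary hyperplane `{y 0 = 0}` and is `≥ 0` on the inward unit vector
`e₀` (Mathlib's `IsLocalMinOn.hasFDerivWithinAt_eq_zero` / `_nonneg` with the positive tangent
cone of the half-space); so `duₚ w = (w 0) · duₚ e₀`, and if `duₚ ≠ 0` then `duₚ e₀ > 0`.
Consequently **two such functions with nonzero differentials at `p` have positively proportional
differentials**: a tangent vector on which one is positive makes the other positive
(`mfderiv_pos_iff_of_isLocalMin`).  At an interior point the hypotheses force `duₚ = 0`, so the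
statements are about boundary points, where they express that both differentials are positive
multiples of the inward conormal (Lee, *Introduction to Smooth Manifolds* (2013), Prop. 5.41 and
the discussion of inward-pointing vectors, p. 118; Milnor 1965, Def. 3.1: a Morse function on a
triad has `f⁻¹(0) = V₀` as a regular level, i.e. `f` is a boundary defining function near `V₀`).

## References

* J. M. Lee, *Introduction to Smooth Manifolds*, 2nd ed. (2013), Prop. 5.41, p. 118.
  [LeeSmoothManifolds2013]
* J. Milnor, *Lectures on the h-cobordism theorem* (1965), Def. 3.1 (PDF p. 11). [MilnorHCobordism1965]
-/

open scoped Manifold ContDiff Topology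
open Set Function Filter

noncomputable section

namespace Literature.Topology.FourManifolds

/-- Local notation: `𝔼 n` is the model Euclidean space `EuclideanSpace ℝ (Fin n)`. -/
local notation "𝔼 " n:arg => EuclideanSpace ℝ (Fin n)

section LocalMin

variable {n : ℕ} {K : Type*} [TopologicalSpace K] [ChartedSpace (EuclideanHalfSpace (n + 1)) K]
  {u v : K → ℝ} {p : K}

/-- The inward unit vector `e₀` of the model half-space `{y | 0 ≤ y 0}`. [folklore] -/
abbrev inwardUnit (n : ℕ) : 𝔼 (n + 1) := EuclideanSpace.single 0 1

/-- The `0`-th coordinate of `e₀` is `1`. [folklore] -/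
@[simp] theorem inwardUnit_apply_zero (n : ℕ) : inwardUnit n 0 = 1 := by
  simp [inwardUnit]

/-- A vector of the model space splits as `(w 0) • e₀` plus a vector tangent to the boundary
hyperplane. [folklore] -/
theorem sub_smul_inwardUnit_apply_zero (w : 𝔼 (n + 1)) : (w - w 0 • inwardUnit n) 0 = 0 := by
  simp [inwardUnit]

/-- A continuous linear form on the model space which kills the boundary hyperplane
`{w | w 0 = 0}` is `w ↦ (w 0) · L e₀`. [folklore] -/
theorem apply_eq_mul_apply_inwardUnit (L : 𝔼 (n + 1) →L[ℝ] ℝ)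
    (hL : ∀ w : 𝔼 (n + 1), w 0 = 0 → L w = 0) (w : 𝔼 (n + 1)) :
    L w = w 0 * L (inwardUnit n) := by
  have h := hL _ (sub_smul_inwardUnit_apply_zero w)
  rw [map_sub, map_smul, sub_eq_zero] at h
  rw [h, smul_eq_mul]

/-- **Fermat on the half-space, tangential directions**: at a local minimum of `u` the
differential kills the vectors tangent to the boundary hyperplane (both `w` and `-w` point into
the half-space). [cite: LeeSmoothManifolds2013, Prop. 5.41 and p. 118] -/
theorem mfderiv_apply_eq_zero_of_isLocalMin (hu : MDifferentiableAt (𝓡∂ (n + 1)) 𝓘(ℝ, ℝ) u p)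
    (hmin : ∀ᶠ q in 𝓝 p, u p ≤ u q) {w : 𝔼 (n + 1)} (hw : w 0 = 0) :
    mlineDeriv (𝓡∂ (n + 1)) u p w = 0 := by
  have hd := hu.hasMFDerivAt.2
  set x₀ := extChartAt (𝓡∂ (n + 1)) p p with hx₀
  have hx₀0 : 0 ≤ x₀ 0 := by
    have : x₀ ∈ range (𝓡∂ (n + 1)) := extChartAt_target_subset_range _ (mem_extChartAt_target _)
    rw [range_modelWithCornersEuclideanHalfSpace] at this
    exact this
  have hminOn : IsLocalMinOn (writtenInExtChartAt (𝓡∂ (n + 1)) 𝓘(ℝ, ℝ) p u)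
      (range (𝓡∂ (n + 1))) x₀ := by
    have ht : Tendsto (extChartAt (𝓡∂ (n + 1)) p).symm (𝓝[range (𝓡∂ (n + 1))] x₀) (𝓝 p) :=
      (map_extChartAt_symm_nhdsWithin_range (I := 𝓡∂ (n + 1)) p).le
    have hev := ht.eventually hmin
    show ∀ᶠ y in 𝓝[range (𝓡∂ (n + 1))] x₀, _ ≤ _
    filter_upwards [hev] with y hy
    simpa only [writtenInExtChartAt, extChartAt_model_space_eq_id, PartialEquiv.refl_coe,
      Function.comp_apply, id_eq, hx₀, extChartAt_to_inv] using hy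
  have hcone : ∀ w : 𝔼 (n + 1), w 0 = 0 → w ∈ posTangentConeAt (range (𝓡∂ (n + 1))) x₀ := by
    intro w hw
    refine mem_posTangentConeAt_of_segment_subset (segment_subset_iff ℝ |>.2 fun a b ha hb hab => ?_)
    rw [range_modelWithCornersEuclideanHalfSpace]
    show 0 ≤ (a • x₀ + b • (x₀ + w)) 0
    simp only [PiLp.add_apply, PiLp.smul_apply, smul_eq_mul, hw, add_zero]
    nlinarith
  have hnw : (-w) 0 = 0 := by simp [hw]
  exact hminOn.hasFDerivWithinAt_eq_zero hd (hcone w hw) (hcone (-w) hnw)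

/-- **Fermat on the half-space, the inward direction**: at a local minimum of `u` the
differential is `≥ 0` on the inward unit vector. [cite: LeeSmoothManifolds2013, Prop. 5.41 and p. 118] -/
theorem mfderiv_inwardUnit_nonneg_of_isLocalMin (hu : MDifferentiableAt (𝓡∂ (n + 1)) 𝓘(ℝ, ℝ) u p)
    (hmin : ∀ᶠ q in 𝓝 p, u p ≤ u q) :
    0 ≤ mlineDeriv (𝓡∂ (n + 1)) u p (inwardUnit n) := by
  have hd := hu.hasMFDerivAt.2
  set x₀ := extChartAt (𝓡∂ (n + 1)) p p with hx₀
  have hx₀0 : 0 ≤ x₀ 0 := by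
    have : x₀ ∈ range (𝓡∂ (n + 1)) := extChartAt_target_subset_range _ (mem_extChartAt_target _)
    rw [range_modelWithCornersEuclideanHalfSpace] at this
    exact this
  have hminOn : IsLocalMinOn (writtenInExtChartAt (𝓡∂ (n + 1)) 𝓘(ℝ, ℝ) p u)
      (range (𝓡∂ (n + 1))) x₀ := by
    have ht : Tendsto (extChartAt (𝓡∂ (n + 1)) p).symm (𝓝[range (𝓡∂ (n + 1))] x₀) (𝓝 p) :=
      (map_extChartAt_symm_nhdsWithin_range (I := 𝓡∂ (n + 1)) p).le
    have hev := ht.eventually hmin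
    show ∀ᶠ y in 𝓝[range (𝓡∂ (n + 1))] x₀, _ ≤ _
    filter_upwards [hev] with y hy
    simpa only [writtenInExtChartAt, extChartAt_model_space_eq_id, PartialEquiv.refl_coe,
      Function.comp_apply, id_eq, hx₀, extChartAt_to_inv] using hy
  have hcone : inwardUnit n ∈ posTangentConeAt (range (𝓡∂ (n + 1))) x₀ := by
    refine mem_posTangentConeAt_of_segment_subset (segment_subset_iff ℝ |>.2 fun a b ha hb hab => ?_)
    rw [range_modelWithCornersEuclideanHalfSpace]
    show 0 ≤ (a • x₀ + b • (x₀ + inwardUnit n)) 0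
    simp only [PiLp.add_apply, PiLp.smul_apply, smul_eq_mul, inwardUnit_apply_zero]
    nlinarith
  exact hminOn.hasFDerivWithinAt_nonneg hd hcone

/-- **The differential at a local minimum is `(w 0) · duₚ(e₀)`.** [cite: LeeSmoothManifolds2013, Prop. 5.41 and p. 118] -/
theorem mfderiv_apply_eq_of_isLocalMin (hu : MDifferentiableAt (𝓡∂ (n + 1)) 𝓘(ℝ, ℝ) u p)
    (hmin : ∀ᶠ q in 𝓝 p, u p ≤ u q) (w : 𝔼 (n + 1)) :
    mlineDeriv (𝓡∂ (n + 1)) u p w = w 0 * mlineDeriv (𝓡∂ (n + 1)) u p (inwardUnit n) :=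
  apply_eq_mul_apply_inwardUnit (mfderiv (𝓡∂ (n + 1)) 𝓘(ℝ, ℝ) u p)
    (fun _ hw => mfderiv_apply_eq_zero_of_isLocalMin hu hmin hw) w

/-- **If moreover `duₚ ≠ 0` then `duₚ(e₀) > 0`** (so `p` is a boundary point and `duₚ` is a
positive multiple of the inward conormal). [cite: LeeSmoothManifolds2013, Prop. 5.41 and p. 118] -/
theorem mfderiv_inwardUnit_pos_of_isLocalMin (hu : MDifferentiableAt (𝓡∂ (n + 1)) 𝓘(ℝ, ℝ) u p)
    (hmin : ∀ᶠ q in 𝓝 p, u p ≤ u q) (h0 : mfderiv (𝓡∂ (n + 1)) 𝓘(ℝ, ℝ) u p ≠ 0) :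
    0 < mlineDeriv (𝓡∂ (n + 1)) u p (inwardUnit n) := by
  refine lt_of_le_of_ne (mfderiv_inwardUnit_nonneg_of_isLocalMin hu hmin) fun h => h0 ?_
  ext w
  change mlineDeriv (𝓡∂ (n + 1)) u p w = 0
  rw [mfderiv_apply_eq_of_isLocalMin hu hmin w, ← h, mul_zero]

/-- **Two functions with a local minimum at `p` and nonzero differentials there have positively
proportional differentials**: a tangent vector on which one differential is positive makes the
other positive (both are positive multiples of the inward conormal; for the two Morse functions
of a triad vanishing exactly on the incoming boundary, Milnor 1965, Def. 3.1, this says that a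
gradient-like vector field of one is transverse inward for the other).
[cite: LeeSmoothManifolds2013, Prop. 5.41 and p. 118] [cite: MilnorHCobordism1965, Def. 3.1 (PDF p. 11)] -/
theorem mfderiv_pos_iff_of_isLocalMin (hu : MDifferentiableAt (𝓡∂ (n + 1)) 𝓘(ℝ, ℝ) u p)
    (hv : MDifferentiableAt (𝓡∂ (n + 1)) 𝓘(ℝ, ℝ) v p) (hminu : ∀ᶠ q in 𝓝 p, u p ≤ u q)
    (hminv : ∀ᶠ q in 𝓝 p, v p ≤ v q) (hu0 : mfderiv (𝓡∂ (n + 1)) 𝓘(ℝ, ℝ) u p ≠ 0)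
    (hv0 : mfderiv (𝓡∂ (n + 1)) 𝓘(ℝ, ℝ) v p ≠ 0) (w : 𝔼 (n + 1)) :
    0 < mlineDeriv (𝓡∂ (n + 1)) u p w ↔ 0 < mlineDeriv (𝓡∂ (n + 1)) v p w := by
  rw [mfderiv_apply_eq_of_isLocalMin hu hminu w, mfderiv_apply_eq_of_isLocalMin hv hminv w,
    mul_pos_iff_of_pos_right (mfderiv_inwardUnit_pos_of_isLocalMin hu hminu hu0),
    mul_pos_iff_of_pos_right (mfderiv_inwardUnit_pos_of_isLocalMin hv hminv hv0)]

end LocalMin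

end Literature.Topology.FourManifolds
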